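import Summits.PneNP.PneNP.Theorems.ChebyshevTracialDesignGammaDirectionCriterion
import HarnessLib

/-!
# Cell pnp-psdrank, route `ChebyshevTracialDesign`: the centred conditional moments of `n_A` given `X = x` as pinned shell laws
# (crux `TracialDecayExp20`, stmt-PneNP-19878)

Brick 131 (prover g26; MEMO-29 §3). Brick 130's criterion for the γ-direction asks, at each bulk point `x`, for relative level-smoothness of three profiles:
the law `c ↦ law_c(x)`, the centred first moment `B^m_c(x) = E_c[1_{X=x}(n_A − m)]` and the centred second moment `A^m_c(x) = E_c[1_{X=x}(n_A − m)²]`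
(`n_A` = number of `HH` edges of `M` inside `U`, `m = m(x)` a free centring). This file writes the two moment profiles in the CURRENCY OF SHELL LAWS — the
objects all of the cell's smoothness technology (Literature `ShellLawSmoothing`, `ShellLawBulkSmoothness`, `HypergeometricRatioWindow`, `TrinomialLineSection`)
speaks about — by full-edge pinning (Literature `ShellLawFullEdgeMoments`, brick 129a §3) with the INDICATOR profile `ψ = 1_{x}`:

* §1 `shellAvg_indicator_eq_law` (`E_{Shell}[1_{|W∩H|+σ = x}] = law(x − σ)` on any ground set), `sectionAvg_eq` (`(Σ_{U: X=x} g)/|Shell_c| = E_c[1_{X=x}·g]`).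
* §2 **`centredFirst_eq_laws`**: for odd `t = t₀+2`, odd `c ≤ t`, `t + c ≤ n`:
  `B^m_c(x) = ((t−c)/n)·Σ_{v∈reps(vAA)} law^{(v)}_c(x−2) − m·law_c(x)`, `law^{(v)}` the law on `[n] ∖ e_v` at cut `t−2`;
  **`centredSecond_eq_laws`**: for odd `t = t₀+4`, odd `c ≤ t`, `t + c ≤ n`:
  `A^m_c(x) = ((t−c)(t−2−c)/(n(n−2)))·Σ_{v≠w} law^{(vw)}_c(x−4) + (1−2m)((t−c)/n)·Σ_v law^{(v)}_c(x−2) + m²·law_c(x)`, `law^{(vw)}` on `[n] ∖ e_v ∖ e_w` at cut `t−4`.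
  (All `law^{(v)}`, resp. `law^{(vw)}`, coincide — the deleted configurations are isomorphic, of `H`-type `(a−1,b,d)`, resp. `(a−2,b,d)` — but the sums are kept.)
READING (MEMO-29 §3): hypotheses (ii)/(iii) of brick 130 are inequalities between the level profiles of THREE shell laws of neighbouring `H`-types at shifted
arguments, with the explicit level-polynomial pinning weights; `A^m_1(x) = law_1(x)·Var_1(n_A | X=x)` is a difference of terms of size `≍ (N/8)²·law` leaving
`≍ (N/60)·law` (kit j318361/j318467), so (ii) is NOT a termwise consequence of the laws' own smoothness: it is a statement about the level-smoothness of a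
second TYPE-difference of laws — the "line-section law one dimension up" (lit `TrinomialLineSection`).
WHAT THIS FILE DOES NOT DO: prove (ii)/(iii), choose the centring `m(x) = E_1[n_A | X=x]` (immediate from §2: `B^m_1(x) = 0` iff `m·law_1(x) = ((t−1)/n)Σ_v law^{(v)}_1(x−2)`),
anything on `TracialDecayExp20` itself, psd rank of P_PM(K_n), or P vs NP.
[cite: Rothvoss2017, §2 (PDF p. 6)] [cite: GodsilMeagher2015, §15.2]
Stature: support/instrument (kernel lane, no defs, axioms standard). Supports stmt-PneNP-19878.
-/

set_option linter.dupNamespace false -- `Summit.PneNP.PneNP.…`: summit = sub-problem (D-0017)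

noncomputable section

namespace Summit.PneNP.PneNP.Theorems.ChebyshevTracialDesignGammaDirectionCentredMoments

open Finset Polynomial Literature.Barriers.PneNP Literature.Combinatorics.Optimization
open Literature.Combinatorics.Optimization.ShellStep
open Summit.PneNP.PneNP.Theorems.ChebyshevTracialDesignGammaDirectionTools (shellAvg_hhCount_eq shellAvg_hhPairs_eq)

variable {n : ℕ}

/-! ### §1 Indicator profiles are laws; section sums are indicator averages -/

/-- **The average of a shifted indicator is the law at the shifted point**: on any ground set `S`,
`(Σ_{W ∈ Shell_S(t,c)} 1[|W∩H| + σ = x]) / |Shell_S(t,c)| = law_S(t,c; x − σ)`. [cite: Rothvoss2017, §2 (PDF p. 6)] -/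
theorem shellAvg_indicator_eq_law (π : Fin n → Fin n) (S H : Finset (Fin n)) (t c : ℕ) (σ x : ℤ) (ind : ℤ → ℝ)
    (hind : ∀ y, ind y = if y = x then 1 else 0) :
    (∑ W ∈ shellIn π S t c, ind (((W ∩ H).card : ℤ) + σ)) / ((shellIn π S t c).card : ℝ) = shellLaw π S H t c (x - σ) := by
  rw [shellLaw, shellCount]
  congr 1
  rw [card_filter]
  push_cast
  refine sum_congr rfl fun W _ => ?_
  rw [hind]
  by_cases h : ((W ∩ H).card : ℤ) + σ = x
  · rw [if_pos h, if_pos (by omega)]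
  · rw [if_neg h, if_neg (by omega)]

/-- **Section sums are indicator averages**: `(Σ_{U ∈ Shell_c(M), |U∩H| = x} g(U))/|Shell_c(M)| = (Σ_{U ∈ Shell_c(M)} 1[|U∩H| = x]·g(U))/|Shell_c(M)|`.
[cite: Rothvoss2017, §2 (PDF p. 6)] -/
theorem sectionSum_eq (t c : ℕ) (M : PMatch n) (H : Finset (Fin n)) (x : ℤ) (g : Finset (Fin n) → ℝ) (ind : ℤ → ℝ)
    (hind : ∀ y, ind y = if y = x then 1 else 0) :
    ∑ U ∈ ((shell M.2.partner t c).filter fun U => ((U ∩ H).card : ℤ) = x), g U =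
      ∑ U ∈ shell M.2.partner t c, ind ((U ∩ H).card : ℤ) * g U := by
  rw [sum_filter]
  refine sum_congr rfl fun U _ => ?_
  rw [hind]
  by_cases h : ((U ∩ H).card : ℤ) = x
  · simp only [h, if_true, one_mul]
  · simp only [h, if_false, zero_mul]

/-! ### §2 The centred first and second moments in the currency of shell laws -/

/-- **The centred first-moment section via pinned laws.** For a perfect matching `M` (partner map `π`), a block `H`, an odd cut `t₀+2`, an odd level `c ≤ t₀+2`
with `t₀+2+c ≤ n`, every `x ∈ ℤ` and every real `m`:
`(Σ_{U ∈ Shell_c(M), |U∩H| = x} (n_A(U) − m))/|Shell_c(M)| = ((t₀+2−c)/n)·Σ_{v ∈ reps(vAA)} law_{[n]∖e_v}(t₀,c; x−2) − m·law_{[n]}(t₀+2,c; x)`.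
[cite: Rothvoss2017, §2 (PDF p. 6)] [cite: GodsilMeagher2015, §15.2] -/
theorem centredFirst_eq_laws (M : PMatch n) (H : Finset (Fin n)) {t₀ c : ℕ}
    (ht : Odd (t₀ + 2)) (hc : Odd c) (hct : c ≤ t₀ + 2) (hn : t₀ + 2 + c ≤ n) (x : ℤ) (m : ℝ) :
    (∑ U ∈ ((shell M.2.partner (t₀ + 2) c).filter fun U => ((U ∩ H).card : ℤ) = x),
        (((((reps M.2.partner (vAA M.2.partner univ H)).filter fun v => v ∈ U ∧ M.2.partner v ∈ U).card : ℕ) : ℝ) - m)) /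
        ((shell M.2.partner (t₀ + 2) c).card : ℝ) =
      (((t₀ : ℝ) + 2 - c) / (n : ℝ)) * ∑ v ∈ reps M.2.partner (vAA M.2.partner univ H), shellLaw M.2.partner (univ \ {v, M.2.partner v}) H t₀ c (x - 2) -
        m * shellLaw M.2.partner univ H (t₀ + 2) c x := by
  obtain ⟨ind, hind⟩ : ∃ ind : ℤ → ℝ, ∀ y, ind y = if y = x then 1 else 0 := ⟨fun y => if y = x then 1 else 0, fun _ => rfl⟩
  rw [sectionSum_eq (t₀ + 2) c M H x _ ind hind]
  have hsplit : ∑ U ∈ shell M.2.partner (t₀ + 2) c, ind ((U ∩ H).card : ℤ) *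
      (((((reps M.2.partner (vAA M.2.partner univ H)).filter fun v => v ∈ U ∧ M.2.partner v ∈ U).card : ℕ) : ℝ) - m) =
      ∑ U ∈ shell M.2.partner (t₀ + 2) c, ind ((U ∩ H).card : ℤ) *
        ((((reps M.2.partner (vAA M.2.partner univ H)).filter fun v => v ∈ U ∧ M.2.partner v ∈ U).card : ℕ) : ℝ) -
      m * ∑ U ∈ shell M.2.partner (t₀ + 2) c, ind (((U ∩ H).card : ℤ) + 0) := by
    rw [mul_sum, ← sum_sub_distrib]
    refine sum_congr rfl fun U _ => ?_
    simp only [add_zero]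
    ring
  rw [hsplit, sub_div, shellAvg_hhCount_eq M H ind ht hc hct hn, mul_div_assoc, ← shellIn_univ M.2.partner (t₀ + 2) c,
    shellAvg_indicator_eq_law M.2.partner univ H (t₀ + 2) c 0 x ind hind, sub_zero,
    sum_congr rfl fun v _ => shellAvg_indicator_eq_law M.2.partner _ H t₀ c 2 x ind hind]

/-- **The centred second-moment section via pinned laws.** For a perfect matching `M`, a block `H`, an odd cut `t₀+4`, an odd level `c ≤ t₀+4` with
`t₀+4+c ≤ n`, every `x ∈ ℤ` and every real `m`:
`(Σ_{U ∈ Shell_c(M), |U∩H| = x} (n_A(U) − m)²)/|Shell_c(M)| = ((t₀+4−c)(t₀+2−c)/(n(n−2)))·Σ_{v}Σ_{w ≠ v} law_{[n]∖e_v∖e_w}(t₀,c; x−4)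
 + (1 − 2m)·((t₀+4−c)/n)·Σ_v law_{[n]∖e_v}(t₀+2,c; x−2) + m²·law_{[n]}(t₀+4,c; x)` (`(n_A−m)² = n_A(n_A−1) + (1−2m)n_A + m²`).
[cite: Rothvoss2017, §2 (PDF p. 6)] [cite: GodsilMeagher2015, §15.2] -/
theorem centredSecond_eq_laws (M : PMatch n) (H : Finset (Fin n)) {t₀ c : ℕ}
    (ht : Odd (t₀ + 4)) (hc : Odd c) (hct : c ≤ t₀ + 4) (hn : t₀ + 4 + c ≤ n) (x : ℤ) (m : ℝ) :
    (∑ U ∈ ((shell M.2.partner (t₀ + 4) c).filter fun U => ((U ∩ H).card : ℤ) = x),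
        (((((reps M.2.partner (vAA M.2.partner univ H)).filter fun v => v ∈ U ∧ M.2.partner v ∈ U).card : ℕ) : ℝ) - m) ^ 2) /
        ((shell M.2.partner (t₀ + 4) c).card : ℝ) =
      ((((t₀ : ℝ) + 4 - c) * ((t₀ : ℝ) + 2 - c)) / ((n : ℝ) * ((n : ℝ) - 2))) *
          ∑ v ∈ reps M.2.partner (vAA M.2.partner univ H), ∑ w ∈ (reps M.2.partner (vAA M.2.partner univ H)).erase v,
            shellLaw M.2.partner (del2 M.2.partner univ v w) H t₀ c (x - 4) +
        (1 - 2 * m) * ((((t₀ : ℝ) + 4 - c) / (n : ℝ)) * ∑ v ∈ reps M.2.partner (vAA M.2.partner univ H),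
            shellLaw M.2.partner (univ \ {v, M.2.partner v}) H (t₀ + 2) c (x - 2)) +
        m ^ 2 * shellLaw M.2.partner univ H (t₀ + 4) c x := by
  obtain ⟨ind, hind⟩ : ∃ ind : ℤ → ℝ, ∀ y, ind y = if y = x then 1 else 0 := ⟨fun y => if y = x then 1 else 0, fun _ => rfl⟩
  rw [sectionSum_eq (t₀ + 4) c M H x _ ind hind]
  have hsplit : ∑ U ∈ shell M.2.partner (t₀ + 4) c, ind ((U ∩ H).card : ℤ) *
      (((((reps M.2.partner (vAA M.2.partner univ H)).filter fun v => v ∈ U ∧ M.2.partner v ∈ U).card : ℕ) : ℝ) - m) ^ 2 =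
      ∑ U ∈ shell M.2.partner (t₀ + 4) c, ind ((U ∩ H).card : ℤ) *
        (((((reps M.2.partner (vAA M.2.partner univ H)).filter fun v => v ∈ U ∧ M.2.partner v ∈ U).card : ℕ) : ℝ) *
          (((((reps M.2.partner (vAA M.2.partner univ H)).filter fun v => v ∈ U ∧ M.2.partner v ∈ U).card : ℕ) : ℝ) - 1)) +
      (1 - 2 * m) * ∑ U ∈ shell M.2.partner (t₀ + 4) c, ind ((U ∩ H).card : ℤ) *
        ((((reps M.2.partner (vAA M.2.partner univ H)).filter fun v => v ∈ U ∧ M.2.partner v ∈ U).card : ℕ) : ℝ) +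
      m ^ 2 * ∑ U ∈ shell M.2.partner (t₀ + 4) c, ind (((U ∩ H).card : ℤ) + 0) := by
    rw [mul_sum, mul_sum, ← sum_add_distrib, ← sum_add_distrib]
    refine sum_congr rfl fun U _ => ?_
    simp only [add_zero]
    ring
  have ht₂ : Odd (t₀ + 2 + 2) := by rw [show t₀ + 2 + 2 = t₀ + 4 by ring]; exact ht
  have h1 := shellAvg_hhCount_eq M H ind (t₀ := t₀ + 2) (c := c) ht₂ hc (by omega) (by omega)
  rw [show t₀ + 2 + 2 = t₀ + 4 by ring] at h1
  rw [hsplit, add_div, add_div, mul_div_assoc, mul_div_assoc, shellAvg_hhPairs_eq M H ind ht hc hct hn, h1,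
    ← shellIn_univ M.2.partner (t₀ + 4) c, shellAvg_indicator_eq_law M.2.partner univ H (t₀ + 4) c 0 x ind hind, sub_zero]
  have e1 : ∀ v ∈ reps M.2.partner (vAA M.2.partner univ H), ∀ w ∈ (reps M.2.partner (vAA M.2.partner univ H)).erase v,
      (∑ U'' ∈ shellIn M.2.partner (del2 M.2.partner univ v w) t₀ c,
          ind (((U'' ∩ H).card : ℤ) + 4)) /
        ((shellIn M.2.partner (del2 M.2.partner univ v w) t₀ c).card : ℝ) =
      shellLaw M.2.partner (del2 M.2.partner univ v w) H t₀ c (x - 4) :=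
    fun v _ w _ => shellAvg_indicator_eq_law M.2.partner _ H t₀ c 4 x ind hind
  have e2 : ∀ v ∈ reps M.2.partner (vAA M.2.partner univ H),
      (∑ U' ∈ shellIn M.2.partner (univ \ {v, M.2.partner v}) (t₀ + 2) c,
          ind (((U' ∩ H).card : ℤ) + 2)) /
        ((shellIn M.2.partner (univ \ {v, M.2.partner v}) (t₀ + 2) c).card : ℝ) =
      shellLaw M.2.partner (univ \ {v, M.2.partner v}) H (t₀ + 2) c (x - 2) :=
    fun v _ => shellAvg_indicator_eq_law M.2.partner _ H (t₀ + 2) c 2 x ind hind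
  rw [sum_congr rfl fun v hv => sum_congr rfl fun w hw => e1 v hv w hw, sum_congr rfl e2]
  push_cast
  ring

end Summit.PneNP.PneNP.Theorems.ChebyshevTracialDesignGammaDirectionCentredMoments

end
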